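import Summits.ResolutionOfSingularities.ResolutionOfSingularities.Theorems.FrobeniusClosingCampaignW41Core4HahnIndependence
import Mathlib.RingTheory.Valuation.ValuationSubring
import Mathlib.FieldTheory.Finite.Basic
import HarnessLib

/-!
# Crux `Steer` (stmt-16345), chain W4.1 / kill test K4.1b: values `ℤ[1/p]` of the datum's base field, residues, centres

OURS (campaign `res-hironaka`, rung L, slot W4.1; replaces the role of no printed item; NOT a statement of
the manuscript under review). Fifth brick of the KERNEL inhabitant of the dim-`≥ 4` Steer core (K4.1b
«ALIVE-BY-KERNEL», seat res-L0-k41):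

* `isMaximal_centre_of_zeroDim'` — the centre of a zero-dimensional valuation ring on a subalgebra is maximal
  (re-proved Theses-free; same argument as `Theorems/ValuativeLuAlphaPTorsorChartRegular.lean`).
* `order_inv_of_ne_zero`, `order_zpow_of_ne_zero` — orders of inverses / integer powers of Hahn series.
* `zeroDim_comap` — restricted valuation rings of `𝒪` over `𝔽_p` are zero-dimensional (`X ^ p - X`).
* `exists_val_inv_pow`, `exists_nsmul_order_eq` — `𝔽_p(x^p, κ^p) ⊂ Ω` contains non-zero elements of value
  `p^{-n}` for every `n`, hence every `γ ∈ ℤ[1/p]` is `p •` a value of that field: the value group of the datum's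
  base field is EXACTLY `ℤ[1/p]`, `p`-divisible (the input of stub-2's `core4Negatives_of_pDivisible`).

No `Theses.*` / `Cruxes.*` import (chain build rule). [folklore]
-/

-- layout-mandated namespace `Summit.<Summit>.<Problem>.…` with Summit = Problem (single-conjunct summit)
set_option linter.dupNamespace false

namespace Summit.ResolutionOfSingularities.ResolutionOfSingularities.Theorems.SwitchingDichotomy.Core4Hahn

open Literature.AlgebraicGeometry.Resolution

/-! ## Two generic facts -/

/-- The centre of a zero-dimensional valuation ring on a `k`-subalgebra `R ⊆ O` is a MAXIMAL ideal of `R`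
(the quotient is a domain algebraic over `k`). Adapted verbatim from `isMaximal_centre_of_zeroDim`
(`Theorems/ValuativeLuAlphaPTorsorChartRegular.lean`), re-proved here to keep this file Theses-free. [folklore] -/
theorem isMaximal_centre_of_zeroDim' {k K : Type} [Field k] [Field K] [Algebra k K] (O : ValuationSubring K)
    (hzd : ∀ z : K, z ∈ O → ∃ f : Polynomial k, f ≠ 0 ∧ Polynomial.aeval z f ∈ O.nonunits)
    (R : Subalgebra k K) (hRO : R.toSubring ≤ O.toSubring) :
    (Ideal.comap (Subring.inclusion hRO) (IsLocalRing.maximalIdeal O)).IsMaximal := by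
  classical
  set 𝔭 : Ideal R.toSubring := Ideal.comap (Subring.inclusion hRO) (IsLocalRing.maximalIdeal O) with h𝔭
  haveI h𝔭p : 𝔭.IsPrime := Ideal.comap_isPrime _ _
  letI : Algebra k R.toSubring := R.algebra
  haveI : IsDomain (R.toSubring ⧸ 𝔭) := Ideal.Quotient.isDomain 𝔭
  have hint : Algebra.IsIntegral k (R.toSubring ⧸ 𝔭) := by
    refine ⟨fun z => ?_⟩
    obtain ⟨r, rfl⟩ := Ideal.Quotient.mk_surjective z
    obtain ⟨f, hf0, hf⟩ := hzd (r : K) (hRO r.2)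
    refine IsAlgebraic.isIntegral ⟨f, hf0, ?_⟩
    have h1 : Polynomial.aeval (Ideal.Quotient.mk 𝔭 r) f =
        Ideal.Quotient.mkₐ k 𝔭 (Polynomial.aeval r f) := by
      rw [← Polynomial.aeval_algHom_apply]
      rfl
    rw [h1, Ideal.Quotient.mkₐ_eq_mk, Ideal.Quotient.eq_zero_iff_mem, h𝔭, Ideal.mem_comap]
    have h2 : ((Polynomial.aeval r f : R.toSubring) : K) = Polynomial.aeval (r : K) f :=
      (Subalgebra.aeval_coe R r f).symm
    have h3 : O.valuation ((Polynomial.aeval r f : R.toSubring) : K) < 1 := by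
      rw [h2]
      exact (ValuationSubring.mem_nonunits_iff O).mp hf
    exact (ValuationSubring.valuation_lt_one_iff O _).mpr h3
  have hfield : IsField (R.toSubring ⧸ 𝔭) := by
    haveI := hint
    exact (Algebra.IsIntegral.isField_iff_isField (R := k) (S := R.toSubring ⧸ 𝔭)
      (FaithfulSMul.algebraMap_injective k _)).mp (Field.toIsField k)
  exact Ideal.Quotient.maximal_of_isField 𝔭 hfield

/-- `order` of an inverse in a Hahn-series field. [folklore] -/
theorem order_inv_of_ne_zero {Γ : Type*} [AddCommGroup Γ] [LinearOrder Γ] [IsOrderedAddMonoid Γ]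
    {k : Type*} [Field k] {h : HahnSeries Γ k} (hh : h ≠ 0) : (h⁻¹).order = -h.order := by
  have h1 : h * h⁻¹ = 1 := mul_inv_cancel₀ hh
  have h2 := congrArg HahnSeries.order h1
  rw [HahnSeries.order_mul hh (inv_ne_zero hh), HahnSeries.order_one] at h2
  exact eq_neg_of_add_eq_zero_right h2

/-- `order` of an integer power in a Hahn-series field. [folklore] -/
theorem order_zpow_of_ne_zero {Γ : Type*} [AddCommGroup Γ] [LinearOrder Γ] [IsOrderedAddMonoid Γ]
    {k : Type*} [Field k] {h : HahnSeries Γ k} (hh : h ≠ 0) (m : ℤ) : (h ^ m).order = m • h.order := by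
  cases m with
  | ofNat n => rw [Int.ofNat_eq_natCast, zpow_natCast, HahnSeries.order_pow, natCast_zsmul]
  | negSucc n =>
    rw [zpow_negSucc, ← inv_pow, HahnSeries.order_pow, order_inv_of_ne_zero hh, smul_neg, negSucc_zsmul]

variable (p : ℕ) [hp : Fact p.Prime]

/-! ## The datum's ambient facts -/

/-- Over `𝔽_p`, restricted valuation rings of `𝒪` are zero-dimensional in the skeleton's sense, witnessed by
the single polynomial `X ^ p - X`. -/
theorem zeroDim_comap (Kf : IntermediateField (ZMod p) (Ω p)) (z : Kf)
    (hz : z ∈ (𝒪 (PInv p) (ZMod p)).comap (algebraMap Kf (Ω p))) :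
    ∃ f : Polynomial (ZMod p), f ≠ 0 ∧
      Polynomial.aeval z f ∈ ((𝒪 (PInv p) (ZMod p)).comap (algebraMap Kf (Ω p))).nonunits := by
  refine ⟨Polynomial.X ^ p - Polynomial.X, FiniteField.X_pow_card_sub_X_ne_zero (ZMod p) hp.out.one_lt, ?_⟩
  rw [mem_nonunits_comap_iff, map_sub, map_pow, Polynomial.aeval_X, map_sub, map_pow]
  exact orderTop_pow_char_sub_self_pos ((mem_comap_𝒪_iff _ _).mp hz)

/-- The «value `p^{-n}`» elements `V n := (zElt n)^p · (x^p)^{-(n+1)p^{R n}}` of `𝔽_p(x^p, κ^p)`. -/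
theorem exists_val_inv_pow (n : ℕ) :
    ∃ V : Ω p, V ∈ IntermediateField.adjoin (ZMod p) ({xElt p ^ p, kser p ^ p} : Set (Ω p)) ∧ V ≠ 0 ∧
      ((V.order : PInv p) : ℚ) = ((p : ℚ) ^ n)⁻¹ := by
  refine ⟨zElt p n ^ p * ((xElt p ^ p) ^ ((n + 1) * p ^ R n))⁻¹, ?_, ?_, ?_⟩
  · refine mul_mem ?_ (inv_mem (pow_mem (IntermediateField.subset_adjoin _ _ (by simp)) _))
    exact IntermediateField.algebra_adjoin_le_adjoin _ _ (zEltPow_mem_adjoin p n)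
  · exact mul_ne_zero (pow_ne_zero _ (zElt_ne_zero p n)) (inv_ne_zero (pow_ne_zero _ (xPow_ne_zero p)))
  · have hx0 : (xElt p ^ p) ^ ((n + 1) * p ^ R n) ≠ 0 := pow_ne_zero _ (xPow_ne_zero p)
    rw [HahnSeries.order_mul (pow_ne_zero _ (zElt_ne_zero p n)) (inv_ne_zero hx0), AddMemClass.coe_add,
      coe_order_zEltPow, order_inv_of_ne_zero hx0, NegMemClass.coe_neg, HahnSeries.order_pow,
      AddSubmonoidClass.coe_nsmul, order_xPow, AddSubmonoidClass.coe_nsmul, coe_one']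
    have hp0 : (p : ℚ) ≠ 0 := (Nat.cast_ne_zero.mpr hp.out.ne_zero)
    simp only [nsmul_eq_mul, mul_one]
    push_cast
    ring

/-- Every element of `ℤ[1/p]` is `p` times the value of a non-zero element of `𝔽_p(x^p, κ^p)`
(the value group of the base field is EXACTLY `ℤ[1/p]`, and `p`-divisible). -/
theorem exists_nsmul_order_eq (γ : PInv p) :
    ∃ V : Ω p, V ∈ IntermediateField.adjoin (ZMod p) ({xElt p ^ p, kser p ^ p} : Set (Ω p)) ∧ V ≠ 0 ∧
      p • V.order = γ := by
  obtain ⟨n, m, hγ⟩ := exists_eq_div_of_mem_PInv hp.out.ne_zero γ.2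
  obtain ⟨V, hV, hV0, hVord⟩ := exists_val_inv_pow p (n + 1)
  refine ⟨V ^ m, zpow_mem hV m, zpow_ne_zero m hV0, ?_⟩
  apply Subtype.ext
  rw [AddSubmonoidClass.coe_nsmul, order_zpow_of_ne_zero hV0, AddSubgroupClass.coe_zsmul, hVord, hγ]
  have hp0 : (p : ℚ) ≠ 0 := (Nat.cast_ne_zero.mpr hp.out.ne_zero)
  simp only [nsmul_eq_mul, zsmul_eq_mul]
  rw [pow_succ]
  field_simp

end Summit.ResolutionOfSingularities.ResolutionOfSingularities.Theorems.SwitchingDichotomy.Core4Hahn
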